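import Summits.AtomisticToContinuum.HydrodynamicLimit.Theorems.LambertianContactSwapContactAngleEquidistributionSumRule
import Summits.AtomisticToContinuum.HydrodynamicLimit.Theorems.LambertianContactSwapContactAngleEquidistributionPsiTMeasurable
import Summits.AtomisticToContinuum.HydrodynamicLimit.Theorems.LambertianContactSwapContactAngleEquidistributionPsiTBound
import Summits.AtomisticToContinuum.HydrodynamicLimit.Theorems.LambertianContactSwapContactAngleEquidistributionPsiTLipschitz
import Summits.AtomisticToContinuum.HydrodynamicLimit.Theorems.LambertianContactSwapContactAngleEquidistributionPsiTHit
import Summits.AtomisticToContinuum.HydrodynamicLimit.Theorems.LambertianContactSwapContactAngleEquidistributionMeas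
import Literature.Analysis.FluidPDE.HardSphereFlowMeasurable
import HarnessLib

/-!
# The crux forces asymptotic isotropy of the collision relative-velocity tensor (line `Sketch` v8,
# stub `stub_velocityIsotropy`; crux `LambertianContactSwap.ContactAngleEquidistribution`, stmt-AtomisticToContinuum-12097)

A CERTIFIED NECESSARY CONDITION for the crux. The crux asserts that under the local Gibbs laws the normalised
`|g|²`-weighted collision sums of `κ_g`-centred admissible marks `ψ_N(s, x, v, w, n)` tend to `0`. Feed it the
collision-difference mark of a quadratic velocity observable `q_N(v) = ⟪v, T_N v⟫`, `‖T_N‖ ≤ 1`: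
`ψ_{T_N}(s, x, v, w, n) = Dq_{T_N}(v, w, n̂)/(12 |v − w|²)` — admissible by `stub_psiT_measurable`, `stub_psiT_bound`,
`stub_psiT_lipschitz` — whose `|g|²`-weighted value at a contact is `1/12` of the collisional change of
`Σᵢ q_N(vᵢ)` (`stub_psiT_hit`). The collision sum rule (`stub_sumRule`) says that the normalised mean of that
collisional change is `O((N+1)^{-1/3})`; subtracting, the crux FORCES
`(N+1)^{-4/3} E_{P_N} Σ_{coll ≤ t} K_{T_N}(vᵢ, vⱼ) → 0`, `K_T(v, w) = ∫ Dq_T(v, w, normalize(−ĝ + ξ̂)) γ(dξ)`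
the `κ_g`-mean of the collisional change (`stub_velocityIsotropy`). On paper `K_T(v, w) = (|g|² tr T − 3⟪g, T g⟫)/6`
(cosine law: `E[cos²θ sin²θ] = 1/6`), so for traceless `T` the crux forces
`(N+1)^{-4/3} E_{P_N} Σ_{coll ≤ t} ⟪g, T_N g⟫ → 0`: the `N^{4/3}`-normalised second-moment tensor of the collision
relative velocities is asymptotically ISOTROPIC under the deterministically evolved local Gibbs state — a
local-Maxwellian-in-collision-average property of the dense deterministic gas (ideator notes F1/F7 of the crux),
the kind of relaxation input catalogued under `Literature.Barriers.AtomisticToContinuum.BoltzmannHypothesisBarrier`.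

* `norm_inv_smul_smul_eq` — `normalize ∘ normalize = normalize` (the Lambertian direction is a unit vector or `0`);
* `weighted_mark_avg_eq` — `|g|² ∫ ψ_T(…, ldir ξ) dγ = (1/12) ∫ Dq_T(v, w, ldir ξ) dγ`;
* `integrable_collisionDiffSum` — the normalised collision sum of collisional changes of `q_N/12` is `P_N`-integrable;
* `stub_velocityIsotropy` — the registered stub.
-/

noncomputable section

open MeasureTheory Filter Set Topology ProbabilityTheory
open scoped ENNReal BigOperators Classical RealInnerProductSpace

namespace Summit.AtomisticToContinuum.HydrodynamicLimit.Theorems.ContactAngleEquidistributionSketch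

open Literature.Analysis.FluidPDE Literature.MathematicalPhysics.KineticTheory
open Summit.AtomisticToContinuum.HydrodynamicLimit.Theses.LambertianContactSwap

/-- Normalising a normalised vector does nothing: `‖s‖⁻¹ • s` is a unit vector or `0`. [folklore] -/
theorem norm_inv_smul_smul_eq (s : V3) : ‖‖s‖⁻¹ • s‖⁻¹ • (‖s‖⁻¹ • s) = ‖s‖⁻¹ • s := by
  by_cases hs : s = 0
  · simp [hs]
  · have h1 : ‖‖s‖⁻¹ • s‖ = 1 := by
      rw [norm_smul, norm_inv, norm_norm, inv_mul_cancel₀ (norm_ne_zero_iff.2 hs)]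
    rw [h1, inv_one, one_smul]

/-- Scalar bookkeeping: `a · ((12 a)⁻¹ · B) = B / 12` provided `B = 0` whenever `a = 0`. [folklore] -/
theorem mul_inv_twelve_mul' {a B : ℝ} (h : a = 0 → B = 0) :
    a * ((12 * a)⁻¹ * B) = 12⁻¹ * B := by
  by_cases ha : a = 0
  · simp [ha, h ha]
  · rw [mul_inv, ← mul_assoc, ← mul_assoc, mul_comm a 12⁻¹, mul_assoc 12⁻¹, mul_inv_cancel₀ ha,
      mul_one]

/-- **The `|g|²`-weighted `κ_g`-average of the mark is `1/12` of the `κ_g`-mean of the collisional change**: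
for every direction map `L` with values in unit-or-zero vectors of the form `‖s‖⁻¹ • s`,
`|v − w|² ∫ ψ_T(s, x, v, w, L ξ) dγ = (1/12) ∫ Dq_T(v, w, L ξ) dγ` (the mark divides by `12|v − w|²` and
normalises its last argument, `norm_inv_smul_smul_eq`; at `v = w` both sides vanish since the reflection of two
equal velocities is the identity). [folklore] -/
theorem weighted_mark_avg_eq (T : V3 →L[ℝ] V3) (γ : Measure V3) (v w : V3) (S : V3 → V3) (s : ℝ) (x : T3) :
    let refl : V3 → V3 × V3 → V3 × V3 := fun n p =>
      (p.1 - ⟪p.1 - p.2, n⟫ • n, p.2 + ⟪p.1 - p.2, n⟫ • n)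
    let Dq : V3 → V3 → V3 → ℝ := fun v w n =>
      ⟪(refl n (v, w)).1, T (refl n (v, w)).1⟫ + ⟪(refl n (v, w)).2, T (refl n (v, w)).2⟫ -
        ⟪v, T v⟫ - ⟪w, T w⟫
    let ψ : ℝ → T3 → V3 → V3 → V3 → ℝ := fun _ _ v w n =>
      (12 * ‖v - w‖ ^ 2)⁻¹ * Dq v w (‖n‖⁻¹ • n)
    ‖v - w‖ ^ 2 * ∫ ξ, ψ s x v w (‖S ξ‖⁻¹ • S ξ) ∂γ = 12⁻¹ * ∫ ξ, Dq v w (‖S ξ‖⁻¹ • S ξ) ∂γ := by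
  intro refl Dq ψ
  rw [← integral_const_mul, ← integral_const_mul]
  refine integral_congr_ae (ae_of_all _ fun ξ => ?_)
  simp only [ψ, norm_inv_smul_smul_eq]
  refine mul_inv_twelve_mul' fun h0 => ?_
  have hvw : v = w := sub_eq_zero.1 (norm_eq_zero.1 ((pow_eq_zero_iff two_ne_zero).1 h0))
  simp [Dq, refl, hvw]

/-- The quadratic observable `12⁻¹ ⟪v, T v⟫` has quadratic growth with constant `12⁻¹` when `‖T‖ ≤ 1`. [folklore] -/
theorem abs_quadObs_le (T : V3 →L[ℝ] V3) (hT : ‖T‖ ≤ 1) (v : V3) :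
    |12⁻¹ * ⟪v, T v⟫| ≤ 12⁻¹ * (1 + ‖v‖ ^ 2) := by
  rw [abs_mul, abs_of_pos (by norm_num : (0 : ℝ) < 12⁻¹)]
  refine mul_le_mul_of_nonneg_left ?_ (by norm_num)
  calc |⟪v, T v⟫| ≤ ‖v‖ * ‖T v‖ := abs_real_inner_le_norm _ _
    _ ≤ ‖v‖ * (‖T‖ * ‖v‖) := by gcongr; exact T.le_opNorm v
    _ ≤ ‖v‖ * (1 * ‖v‖) := by gcongr
    _ = ‖v‖ ^ 2 := by ring
    _ ≤ 1 + ‖v‖ ^ 2 := le_add_of_nonneg_left zero_le_one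

/-- The collision-difference mark of `12⁻¹ ⟪·, T ·⟫`, read on `ℝ × Config`, is jointly measurable for every
ordered pair (`measurable_collidePair`). [folklore] -/
theorem measurable_collisionDiffMark (T : V3 →L[ℝ] V3) {N : ℕ} (i j : Fin (N + 1)) :
    Measurable fun p : ℝ × Config (N + 1) (Fin 3) T3 =>
      12⁻¹ * ⟪(collidePair (Torus.geometry (Fin 3)) i j p.2 i).2, T (collidePair (Torus.geometry (Fin 3)) i j p.2 i).2⟫ +
        12⁻¹ * ⟪(collidePair (Torus.geometry (Fin 3)) i j p.2 j).2, T (collidePair (Torus.geometry (Fin 3)) i j p.2 j).2⟫ -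
        12⁻¹ * ⟪(p.2 i).2, T (p.2 i).2⟫ - 12⁻¹ * ⟪(p.2 j).2, T (p.2 j).2⟫ := by
  have hq : Measurable fun v : V3 => 12⁻¹ * ⟪v, T v⟫ :=
    (continuous_const.mul (continuous_id.inner T.continuous)).measurable
  have hc : Measurable fun p : ℝ × Config (N + 1) (Fin 3) T3 => collidePair (Torus.geometry (Fin 3)) i j p.2 :=
    (Torus.isMeasurable_geometry.measurable_collidePair i j).comp measurable_snd
  have hvi : Measurable fun p : ℝ × Config (N + 1) (Fin 3) T3 =>
      (collidePair (Torus.geometry (Fin 3)) i j p.2 i).2 := ((measurable_pi_apply i).comp hc).snd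
  have hvj : Measurable fun p : ℝ × Config (N + 1) (Fin 3) T3 =>
      (collidePair (Torus.geometry (Fin 3)) i j p.2 j).2 := ((measurable_pi_apply j).comp hc).snd
  have hi : Measurable fun p : ℝ × Config (N + 1) (Fin 3) T3 => (p.2 i).2 :=
    ((measurable_pi_apply i).comp measurable_snd).snd
  have hj : Measurable fun p : ℝ × Config (N + 1) (Fin 3) T3 => (p.2 j).2 :=
    ((measurable_pi_apply j).comp measurable_snd).snd
  exact (((hq.comp hvi).add (hq.comp hvj)).sub (hq.comp hi)).sub (hq.comp hj)

/-- **The crux forces asymptotic isotropy of the collision relative-velocity tensor** (registered stub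
`stub_velocityIsotropy` of line `Sketch` v8; a certified NECESSARY condition for the crux). If
`ContactAngleEquidistribution` holds then for every family of continuous profiles there is `σ₀ > 0` such that for
`0 < σ < σ₀`, every `Φ`, `t ≥ 0` and every sequence of operators `T_N` with `‖T_N‖ ≤ 1`, the normalised collision
sum of the `κ_g`-MEANS of the collisional changes of `Σᵢ ⟪vᵢ, T_N vᵢ⟫`,
`(N+1)^{-4/3} E_{P_N} Σ_{coll ≤ t} ∫ Dq_{T_N}(vᵢ, vⱼ, normalize(−ĝ + ξ̂)) γ(dξ)`, tends to `0`. Proof: the crux at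
the admissible mark `ψ_{T_N}` (`stub_psiT_measurable/bound/lipschitz`) gives `∫ D_N → 0`; the collision sum rule
at `φ_N = ⟪·, T_N ·⟫/12` (`stub_sumRule`, `abs_quadObs_le`) gives `∫ X_N → 0`; pointwise `Y_N = 12 (X_N − D_N)`
(`stub_psiT_hit`, `weighted_mark_avg_eq`); and `X_N` is integrable (`stub_meas`, `measurable_collisionDiffMark`,
`collisionDiffSum_abs_le_of_good`), so `|∫ Y_N| ≤ 12 (|∫ X_N| + |∫ D_N|)` whether or not `D_N` is. On paper the
`κ_g`-mean is `(|g|² tr T − 3⟪g, T g⟫)/6`, whence "velocity isotropy". [folklore] -/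
theorem stub_velocityIsotropy (hCrux : ContactAngleEquidistribution) :
    let Cfg : ℕ → Type := fun N => Config (N + 1) (Fin 3) T3
    let G := Torus.geometry (Fin 3)
    let ε : ℝ → ℕ → ℝ := hsDiameter
    let τ : ℝ → (N : ℕ) → Cfg N → ℝ≥0∞ := fun σ N z => Alexander.freeExitTime G (ε σ N) z
    let S : ℝ → (N : ℕ) → Cfg N → Cfg N := fun t _ z => freeFlight G t z
    let ldir : V3 → V3 → V3 := fun ω ξ => ‖‖ω‖⁻¹ • ω + ‖ξ‖⁻¹ • ξ‖⁻¹ • (‖ω‖⁻¹ • ω + ‖ξ‖⁻¹ • ξ)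
    let zpre : ℝ → (N : ℕ) → Cfg N → ℕ → Cfg N := fun σ N z m =>
      let y := Alexander.stateAfter G (ε σ N) z m; S (τ σ N y).toReal N y
    let Kt : ℝ → (N : ℕ) → Cfg N → ℝ → ℕ := fun σ N z t => Alexander.collisionCount G (ε σ N) z t
    let hit : ℝ → (N : ℕ) → Cfg N → Fin (N + 1) → Fin (N + 1) → Prop := fun σ N y i j =>
      i < j ∧ y ∈ contactSet G (N + 1) (ε σ N) i j ∧ IsIncoming G y i j
    let refl : V3 → V3 × V3 → V3 × V3 := fun n p =>
      (p.1 - ⟪p.1 - p.2, n⟫ • n, p.2 + ⟪p.1 - p.2, n⟫ • n)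
    let Dq : (V3 →L[ℝ] V3) → V3 → V3 → V3 → ℝ := fun T v w n =>
      ⟪(refl n (v, w)).1, T (refl n (v, w)).1⟫ + ⟪(refl n (v, w)).2, T (refl n (v, w)).2⟫ -
        ⟪v, T v⟫ - ⟪w, T w⟫
    ∀ (a₀ θ₀ : T3 → ℝ) (u₀ : T3 → V3), Continuous a₀ → Continuous θ₀ → Continuous u₀ →
      (∀ x, 0 < a₀ x) → (∀ x, 0 < θ₀ x) → ∃ σ₀ : ℝ, 0 < σ₀ ∧ ∀ σ : ℝ, 0 < σ → σ < σ₀ →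
      ∀ Φ : (N : ℕ) → HardSphereFlow G (ε σ N) (N + 1),
      let P := fun N => localGibbsLaw σ a₀ u₀ θ₀ N (Φ N)
      ∀ t : ℝ, 0 ≤ t → ∀ T : ℕ → (V3 →L[ℝ] V3), (∀ N, ‖T N‖ ≤ 1) →
        Tendsto (fun N : ℕ => ∫ z, ((N : ℝ) + 1) ^ (-(4 / 3 : ℝ)) * ∑ m ∈ Finset.range (Kt σ N z t),
          ∑ i : Fin (N + 1), ∑ j : Fin (N + 1),
            (let y := zpre σ N z m
             if hit σ N y i j then
               ∫ ξ, Dq (T N) (y i).2 (y j).2 (ldir (-((y i).2 - (y j).2)) ξ) ∂(stdGaussian V3)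
             else 0) ∂(P N)) atTop (𝓝 0) := by
  intro Cfg G ε τ S ldir zpre Kt hit refl Dq a₀ θ₀ u₀ ha hθ hu ha0 hθ0
  obtain ⟨σ₁, hσ₁, h1⟩ := hCrux a₀ θ₀ u₀ ha hθ hu ha0 hθ0
  refine ⟨min σ₁ 2⁻¹, lt_min hσ₁ (by norm_num), ?_⟩
  intro σ hσ hσlt Φ P t ht T hT
  have hσ1 : σ < σ₁ := hσlt.trans_le (min_le_left _ _)
  have hσ2 : σ < 2⁻¹ := hσlt.trans_le (min_le_right _ _)
  have hσ2' : σ ≤ 1 / 2 := by rw [one_div]; exact hσ2.le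
  -- the admissible collision-difference marks
  set ψ : ℕ → ℝ → T3 → V3 → V3 → V3 → ℝ := fun N _ _ v w n =>
    (12 * ‖v - w‖ ^ 2)⁻¹ * Dq (T N) v w (‖n‖⁻¹ • n) with hψ
  have hψm : ∀ N, Measurable (fun p : ℝ × T3 × V3 × V3 × V3 =>
      ψ N p.1 p.2.1 p.2.2.1 p.2.2.2.1 p.2.2.2.2) := fun N => stub_psiT_measurable (T N)
  have hψb : ∀ N s x v w n, |ψ N s x v w n| ≤ 1 := fun N => stub_psiT_bound (T N) (hT N)
  have hψl : ∀ N s x v w (n n' : V3), ‖n‖ = 1 → ‖n'‖ = 1 →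
      |ψ N s x v w n - ψ N s x v w n'| ≤ ‖n - n'‖ := fun N => stub_psiT_lipschitz (T N) (hT N)
  -- the crux at these marks: `∫ D_N → 0`
  have hD := h1 σ hσ hσ1 Φ t ht ψ hψm hψb hψl
  -- the sum rule at `φ_N = ⟪·, T_N ·⟫ / 12`: `|∫ X_N| ≤ C (N+1)^{-1/3}`
  set φ : ℕ → V3 → ℝ := fun N v => 12⁻¹ * ⟪v, T N v⟫ with hφ
  have hφb : ∀ N v, |φ N v| ≤ 12⁻¹ * (1 + ‖v‖ ^ 2) := fun N v => abs_quadObs_le (T N) (hT N) v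
  obtain ⟨C, hC⟩ := stub_sumRule a₀ θ₀ u₀ ha hθ hu ha0 hθ0 σ hσ hσ2 Φ t 12⁻¹ (by norm_num) φ hφb
  -- names for the three integrands
  set X : (N : ℕ) → Cfg N → ℝ := fun N z => ((N : ℝ) + 1) ^ (-(4 / 3 : ℝ)) *
    ∑ m ∈ Finset.range (Kt σ N z t), ∑ i : Fin (N + 1), ∑ j : Fin (N + 1),
      (let y := zpre σ N z m
       if hit σ N y i j then
         φ N ((collidePair G i j y i).2) + φ N ((collidePair G i j y j).2) - φ N ((y i).2) - φ N ((y j).2)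
       else 0) with hX
  set D : (N : ℕ) → Cfg N → ℝ := fun N z => ((N : ℝ) + 1) ^ (-(4 / 3 : ℝ)) *
    ∑ m ∈ Finset.range (Kt σ N z t), ∑ i : Fin (N + 1), ∑ j : Fin (N + 1),
      (let y := zpre σ N z m
       if hit σ N y i j then
         ‖(y i).2 - (y j).2‖ ^ 2 *
           (ψ N (Alexander.collisionInstant G (ε σ N) z (m + 1)).toReal
               (G.translate (y j).1 ((2 : ℝ)⁻¹ • G.sepVec (y i).1 (y j).1)) (y i).2 (y j).2
               ((ε σ N)⁻¹ • G.sepVec (y i).1 (y j).1) -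
             ∫ ξ, ψ N (Alexander.collisionInstant G (ε σ N) z (m + 1)).toReal
               (G.translate (y j).1 ((2 : ℝ)⁻¹ • G.sepVec (y i).1 (y j).1)) (y i).2 (y j).2
               (ldir (-((y i).2 - (y j).2)) ξ) ∂(stdGaussian V3))
       else 0) with hDdef
  set Y : (N : ℕ) → Cfg N → ℝ := fun N z => ((N : ℝ) + 1) ^ (-(4 / 3 : ℝ)) *
    ∑ m ∈ Finset.range (Kt σ N z t), ∑ i : Fin (N + 1), ∑ j : Fin (N + 1),
      (let y := zpre σ N z m
       if hit σ N y i j then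
         ∫ ξ, Dq (T N) (y i).2 (y j).2 (ldir (-((y i).2 - (y j).2)) ξ) ∂(stdGaussian V3)
       else 0) with hY
  change Tendsto (fun N : ℕ => ∫ z, D N z ∂(P N)) atTop (𝓝 0) at hD
  change Tendsto (fun N : ℕ => ∫ z, Y N z ∂(P N)) atTop (𝓝 0)
  change ∀ N : ℕ, |∫ z, X N z ∂(P N)| ≤ C * ((N : ℝ) + 1) ^ (-(1 / 3 : ℝ)) at hC
  -- pointwise: `Y = 12 (X − D)`
  have hYXD : ∀ N z, Y N z = 12 * (X N z - D N z) := by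
    intro N z
    simp only [hY, hX, hDdef]
    rw [← mul_sub, ← mul_assoc, mul_comm (12 : ℝ), mul_assoc]
    congr 1
    rw [← Finset.sum_sub_distrib, Finset.mul_sum]
    refine Finset.sum_congr rfl fun m _ => ?_
    rw [← Finset.sum_sub_distrib, Finset.mul_sum]
    refine Finset.sum_congr rfl fun i _ => ?_
    rw [← Finset.sum_sub_distrib, Finset.mul_sum]
    refine Finset.sum_congr rfl fun j _ => ?_
    split_ifs with hh
    · -- a hit: contact and `i < j`
      have hij : i ≠ j := ne_of_lt hh.1
      have hcontact : ‖G.sepVec ((zpre σ N z m) i).1 ((zpre σ N z m) j).1‖ = ε σ N :=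
        (mem_contactSet.1 hh.2.1).2
      have he : 0 < ε σ N := hsDiameter_pos hσ N
      have hhit : ‖(zpre σ N z m i).2 - (zpre σ N z m j).2‖ ^ 2 *
          ψ N (Alexander.collisionInstant G (ε σ N) z (m + 1)).toReal
            (G.translate (zpre σ N z m j).1 ((2 : ℝ)⁻¹ • G.sepVec (zpre σ N z m i).1 (zpre σ N z m j).1))
            (zpre σ N z m i).2 (zpre σ N z m j).2 ((ε σ N)⁻¹ • G.sepVec (zpre σ N z m i).1 (zpre σ N z m j).1) =
          12⁻¹ * (⟪(collidePair G i j (zpre σ N z m) i).2, T N (collidePair G i j (zpre σ N z m) i).2⟫ +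
            ⟪(collidePair G i j (zpre σ N z m) j).2, T N (collidePair G i j (zpre σ N z m) j).2⟫ -
            ⟪(zpre σ N z m i).2, T N (zpre σ N z m i).2⟫ - ⟪(zpre σ N z m j).2, T N (zpre σ N z m j).2⟫) :=
        stub_psiT_hit (T N) he (zpre σ N z m) hij hcontact
          (Alexander.collisionInstant G (ε σ N) z (m + 1)).toReal
          (G.translate (zpre σ N z m j).1 ((2 : ℝ)⁻¹ • G.sepVec (zpre σ N z m i).1 (zpre σ N z m j).1))
      have havg : ‖(zpre σ N z m i).2 - (zpre σ N z m j).2‖ ^ 2 *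
          ∫ ξ, ψ N (Alexander.collisionInstant G (ε σ N) z (m + 1)).toReal
            (G.translate (zpre σ N z m j).1 ((2 : ℝ)⁻¹ • G.sepVec (zpre σ N z m i).1 (zpre σ N z m j).1))
            (zpre σ N z m i).2 (zpre σ N z m j).2
            (ldir (-((zpre σ N z m i).2 - (zpre σ N z m j).2)) ξ) ∂(stdGaussian V3) =
          12⁻¹ * ∫ ξ, Dq (T N) (zpre σ N z m i).2 (zpre σ N z m j).2
            (ldir (-((zpre σ N z m i).2 - (zpre σ N z m j).2)) ξ) ∂(stdGaussian V3) :=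
        weighted_mark_avg_eq (T N) (stdGaussian V3) _ _
          (fun ξ => ‖-((zpre σ N z m i).2 - (zpre σ N z m j).2)‖⁻¹ • (-((zpre σ N z m i).2 - (zpre σ N z m j).2)) +
            ‖ξ‖⁻¹ • ξ)
          (Alexander.collisionInstant G (ε σ N) z (m + 1)).toReal
          (G.translate (zpre σ N z m j).1 ((2 : ℝ)⁻¹ • G.sepVec (zpre σ N z m i).1 (zpre σ N z m j).1))
      simp only [hφ]
      linear_combination (12 : ℝ) * hhit - (12 : ℝ) * havg
    · simp
  -- `∫ X_N → 0`
  have hX0 : Tendsto (fun N : ℕ => ∫ z, X N z ∂(P N)) atTop (𝓝 0) := by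
    have hr : Tendsto (fun N : ℕ => C * (((N : ℝ) + 1) ^ (-(1 / 3 : ℝ)))) atTop (𝓝 0) := by
      have h := (tendsto_rpow_neg_atTop (by norm_num : (0 : ℝ) < 1 / 3)).comp
        (tendsto_atTop_add_const_right atTop (1 : ℝ) tendsto_natCast_atTop_atTop)
      simpa using h.const_mul C
    refine squeeze_zero_norm (fun N => ?_) hr
    rw [Real.norm_eq_abs]
    exact hC N
  -- `X_N` is integrable
  have hXi : ∀ N, Integrable (X N) (P N) := by
    intro N
    obtain ⟨C₂, -, hC₂⟩ := exists_integrable_sum_norm_sq_localGibbsLaw ha hθ hu ha0 hθ0 hσ2'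
    obtain ⟨hVint, -⟩ := hC₂ N (Φ N)
    have hPμ : IsProbabilityMeasure (P N) := isProbabilityMeasure_localGibbsLaw ha hθ hu ha0 hθ0 hσ2' N (Φ N)
    have hmeas : Measurable (X N) := by
      have hM := stub_meas σ hσ hσ2 N t
        (fun _ y i j => φ N ((collidePair G i j y i).2) + φ N ((collidePair G i j y j).2) -
          φ N ((y i).2) - φ N ((y j).2))
        (fun i j => measurable_collisionDiffMark (T N) i j)
      exact measurable_const.mul hM
    refine Integrable.mono' ((((integrable_const (((N : ℝ) + 1))).add hVint).const_mul
      (2 * 12⁻¹)).const_mul (((N : ℝ) + 1) ^ (-(4 / 3 : ℝ)))) hmeas.aestronglyMeasurable ?_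
    filter_upwards [ae_mem_alexanderGood_localGibbsLaw hσ hσ2 a₀ θ₀ u₀ N (Φ N)] with z hz
    rw [hX, Real.norm_eq_abs, abs_mul, abs_of_nonneg (by positivity : (0 : ℝ) ≤ ((N : ℝ) + 1) ^ (-(4 / 3 : ℝ)))]
    exact mul_le_mul_of_nonneg_left (collisionDiffSum_abs_le_of_good (hφb N) hz t) (by positivity)
  -- `|∫ Y_N| ≤ 12 (|∫ X_N| + |∫ D_N|)`
  have hkey : ∀ N, ‖∫ z, Y N z ∂(P N)‖ ≤ 12 * (|∫ z, X N z ∂(P N)| + |∫ z, D N z ∂(P N)|) := by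
    intro N
    have hYi : ∫ z, Y N z ∂(P N) = 12 * ∫ z, (X N z - D N z) ∂(P N) := by
      rw [← integral_const_mul]
      exact integral_congr_ae (ae_of_all _ fun z => hYXD N z)
    rw [Real.norm_eq_abs, hYi, abs_mul, abs_of_pos (by norm_num : (0 : ℝ) < 12)]
    refine mul_le_mul_of_nonneg_left ?_ (by norm_num)
    by_cases hDi : Integrable (D N) (P N)
    · rw [integral_sub (hXi N) hDi]
      exact abs_sub _ _
    · have hnot : ¬ Integrable (fun z => X N z - D N z) (P N) := fun h =>
        hDi (((hXi N).sub h).congr (ae_of_all _ fun z => by simp))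
      rw [integral_undef hnot, abs_zero]
      positivity
  refine squeeze_zero_norm hkey ?_
  simpa using ((continuous_abs.tendsto 0).comp hX0 |>.add ((continuous_abs.tendsto 0).comp hD)).const_mul 12

end Summit.AtomisticToContinuum.HydrodynamicLimit.Theorems.ContactAngleEquidistributionSketch

end
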